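import Summits.QuantumFields.BalabanUV.T4Continuum.Support.CTAveragedTowerDecay
import Summits.QuantumFields.BalabanUV.T4Continuum.Support.DirichletRegionTower
import Summits.QuantumFields.BalabanUV.T4Continuum.Support.FirstOrderBackgroundModel

/-!
# T⁴ programme, spine node NE2 (U1a), sub-row Δ3 «NE2-WALK» (T4-DAG `T4-U1a.S-NE2-D3-WALK°`) — THE CONJUGATED (H-bd) OF THE TIER-A
# MODEL PERTURBATIONS at one level: shifts, differences and the weighted gradient of `𝒢 = Δ_a⁻¹` under the Combes–Thomas conjugation,
# hence `‖conjMat P · conjMat 𝒢‖` for the first-order, adjoint first-order and zeroth-order pieces — MODULO the `U = 1` conjugation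
# defect of `Δ_a` (displayed)

NE2 formalisation swarm `b2b-balaban-t4-ne2-formalise-*`, leaf prover 06 (gen 3), supplier item «Δ3-CT-HBD» (follower of «Δ3-CT»,
files `Support/CTAveragedTowerDecay` p220700 + `Support/CTKingTowerWeights` p220892; owner ruling R21 (c), CLAIMS.log l.14713), file C1
(one level `n`; file C2 = the tower ∕ colour assembly for row B2's `covPertC`).  «Δ3-CT» re-typed the decay binder `hdec` of
`Spine/NE2BalabanDecayRate` as `hdec ⇐ hW ∧ hPc` with `hPc : ‖conjMat P_k·conjMat ((Δ_a^{(k)}⊗1)⁻¹)‖ ≤ κ′` a NEW displayed binder of (H-bd) type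
(R21 (c)(iii)).  THIS FILE proves the one-level estimates that discharge `hPc` for the tier-A MODEL perturbations of the lineage
(`FirstOrderBackgroundModel.firstOrder`, its adjoint, `Matrix.diagonal`) from ONE `U = 1` input, the conjugation defect
`hJ : ConjDefect (Δ_a) κ ρ J` (`J < γ_D = ((d+1)Cst)⁻¹`) at a fine-Lipschitz weight `ρ` (`|ρ(x + e_ν, μ) − ρ(x, μ)| ≤ 1/n` — e.g. the
canonical `CTKingTowerWeights.rho`), exactly as rows B2∕B5 discharged the un-conjugated (H-bd) from (1.89):

 * §1 `conjMat` of sums and of the zero matrix; the SHIFT under conjugation — **`opNorm_conjMat_shiftM_sub_le`**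
   (`‖c(S_ν) − S_ν‖ ≤ e^{|κ|/n} − 1`, Schur: one nonzero entry per row and column, weight jump `≤ 1/n`), `opNorm_conjMat_shiftM_le` ∕
   `opNorm_conjMat_shiftMH_le` (`≤ e^{|κ|}`); the DIFFERENCE — **`opNorm_conjMat_fdiff_sub_le`** (`‖c(∇_ν) − ∇_ν‖ ≤ |κ|e^{|κ|}`: the lattice
   factor `n` against `e^{|κ|/n} − 1 ≤ (|κ|/n)e^{|κ|/n}` — the `n`-UNIFORMITY);
 * §2 THE WEIGHTED GRADIENT BOUND **`opNorm_fdiff_mul_conjMat_inv_le`**: `‖∇_ν · c(𝒢)‖ ≤ G₁ := √((d+1)Cst·(γw⁻¹ + J·γw⁻²))`, `γw = γ_D − J`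
   (`CTWeightedCoercivity.WCoercive.form_bound` with the tree's gradient form bound `DirichletRegionTower.nsq_fdiff_le_form`), hence
   **`opNorm_conjMat_fdiff_mul_inv_le`** `‖c(∇_ν)·c(𝒢)‖ ≤ G₁ + |κ|e^{|κ|}γw⁻¹ =: G₂`;
 * §3 THE THREE PIECES: **`opNorm_conjMat_firstOrderPiece_le`** (`‖c(diag W·∇_ν)·c(𝒢)‖ ≤ α·G₂`, `|W| ≤ α`),
   **`opNorm_conjMat_adjointPiece_le`** (`‖c((diag W·∇_ν)ᴴ)·c(𝒢)‖ ≤ e^{|κ|}(α·G₂ + β·γw⁻¹)`, Lipschitz `|W(x + e_ν) − W(x)| ≤ β/n`, via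
   `∇ᴴ = −Sᴴ∇` and the discrete Leibniz rule `BlockPairingGeometry.fdiff_mul_diagonal`), **`opNorm_conjMat_diagonal_mul_inv_le`**
   (`‖c(diag Z)·c(𝒢)‖ ≤ α′·γw⁻¹`), and the sums over directions `opNorm_conjMat_firstOrder_le` ∕ `opNorm_conjMat_firstOrderH_le`
   (`FirstOrderBackgroundModel.firstOrder`).

HONEST FRAMING (T4-DAG p. 1).  One-level lattice linear algebra ([folklore]); statements and constants OURS; the `U = 1` input `hJ` (conjugation
defect of Bałaban's `Δ_a` at fine-Lipschitz weights — the β-cell's `DeltaACombesThomas` proves it MODULO the `∂P∂*` row defect, the substrate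
programme VEC in full) is DISPLAYED, asserted by nobody; nothing printed is a hypothesis; no `def … : Prop`, two real constants (`G1`, `G2`);
no NE row estimated; `hdec` NOT discharged; Δ3 NOT closed; NE2 (U1a) NOT PROVED; spine PROVED 0/9 unchanged; NOT infinite volume, NOT a mass
gap, NOT the Clay problem, NOT summit progress.  HONEST DEPENDENCY: continuum YM on T⁴ ⇐ BetaPertH ∧ nine spine estimates (0/9 proved);
BetaPertH ⇐ (D1) ∧ (D4) ∧ CAP+tail; G-an2-4 gates asym, D1 and NE2/3/4.  ABSOLUTE RULE kept; no `sorry`.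
-/

noncomputable section

open scoped BigOperators ComplexConjugate Matrix Matrix.Norms.L2Operator

namespace Summit.QuantumFields.BalabanUV.T4Continuum.CTConjugatedHbd

open Literature.MathematicalPhysics.QuantumFieldTheory.Balaban1983to89.B5Prop11Plancherel (Cst Cst_nonneg Tor fine fdiff shiftM unitVec
  calG)
open Literature.MathematicalPhysics.QuantumFieldTheory.Balaban1983to89.B5Prop11Inverse (calDa calG_eq_inv calDa_mul_calG)
open Literature.MathematicalPhysics.QuantumFieldTheory.Balaban1983to89.B5Prop11Lower (nsq nsq_nonneg)
open Summit.QuantumFields.BalabanUV.T4Continuum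
open Summit.QuantumFields.BalabanUV.T4Continuum.CoerciveInverseTower (Coercive)
open Summit.QuantumFields.BalabanUV.T4Continuum.ScalarAveragedPropagator (opNorm_le_of_nsq_le_rect)
open Summit.QuantumFields.BalabanUV.T4Continuum.ScalarCovariantCTWeighted (wvec wvec_wvec_neg)
open Summit.QuantumFields.BalabanUV.T4Continuum.CTWeightedCoercivity
open Summit.QuantumFields.BalabanUV.T4Continuum.CTConjugationPieces (conjMat_inv conjMat_of_sameWeight opNorm_conjMat_le_add
  opNorm_conjMat_sub_le_schur nat_mul_exp_div_sub_one_le opNorm_conjMat_conjTranspose_sub_eq conjMat_conjTranspose)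
open Summit.QuantumFields.BalabanUV.T4Continuum.CTAveragedTowerDecay (conjMat_mul_same opNorm_conjMat_inv_le_of_wCoercive)
open Summit.QuantumFields.BalabanUV.T4Continuum.DirichletRegionTower (gamD gamD_pos K_pos coercive_calDa nsq_fdiff_le_form)
open Summit.QuantumFields.BalabanUV.T4Continuum.BlockPairingGeometry (tau fdiff_mul_diagonal opNorm_shiftM_le fdiff_eq_neg_conjTranspose_mul
  opNorm_diagonal_le)
open Summit.QuantumFields.BalabanUV.T4Continuum.FirstOrderBackgroundModel (firstOrder)

/-! ## §1 Sums; shifts and differences under the conjugation -/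

section Algebra

variable {ι τ : Type*} [Fintype ι] [DecidableEq ι] [Fintype τ] [DecidableEq τ]

omit [Fintype ι] [DecidableEq ι] [Fintype τ] [DecidableEq τ] in
/-- the zero matrix is fixed. [folklore] -/
theorem conjMat_zero_matrix (κ : ℝ) (ρ : τ → ℝ) (σ : ι → ℝ) : conjMat κ ρ σ (0 : Matrix τ ι ℂ) = 0 := by
  ext e e'; simp [conjMat_apply]

omit [Fintype ι] [DecidableEq ι] [Fintype τ] [DecidableEq τ] in
/-- `conjMat` of a finite sum. [folklore] -/
theorem conjMat_finset_sum {σ' : Type*} (s : Finset σ') (κ : ℝ) (ρ : τ → ℝ) (σ : ι → ℝ) (f : σ' → Matrix τ ι ℂ) :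
    conjMat κ ρ σ (∑ x ∈ s, f x) = ∑ x ∈ s, conjMat κ ρ σ (f x) := by
  classical
  induction s using Finset.induction_on with
  | empty => rw [Finset.sum_empty, Finset.sum_empty, conjMat_zero_matrix]
  | insert x s hx ih => rw [Finset.sum_insert hx, Finset.sum_insert hx, conjMat_add, ih]

omit [Fintype ι] [DecidableEq ι] [Fintype τ] [DecidableEq τ] in
/-- negation. [folklore] -/
theorem conjMat_neg (κ : ℝ) (ρ : τ → ℝ) (σ : ι → ℝ) (X : Matrix τ ι ℂ) : conjMat κ ρ σ (-X) = -conjMat κ ρ σ X := by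
  ext e e'; simp [conjMat_apply]

omit [Fintype ι] in
/-- a diagonal matrix is fixed. [folklore] -/
theorem conjMat_diagonal (κ : ℝ) (ρ : ι → ℝ) (W : ι → ℂ) : conjMat κ ρ ρ (Matrix.diagonal W) = Matrix.diagonal W :=
  conjMat_of_sameWeight κ ρ ρ _ fun e e' h => by
    by_cases hee : e = e'
    · rw [hee]
    · exact absurd (Matrix.diagonal_apply_ne W hee) h

omit [DecidableEq ι] in
/-- **NON-VACUITY OF THE DISPLAYED INPUT AT RATE `κ = 0`**: every kernel has conjugation defect `0` at `κ = 0` (the conjugation is the identity),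
so `hJ` below holds with `J = 0` and the file's bounds reduce to the un-conjugated (H-bd) of the tier-A rows. [folklore] -/
theorem conjDefect_zero_rate (A : Matrix ι ι ℂ) (ρ : ι → ℝ) : ConjDefect A 0 ρ 0 := fun z => by
  rw [conjForm_eq, conjMat_zero, sub_self, abs_zero, zero_mul]

end Algebra

section OneLevel

variable {d : ℕ} (n : ℕ) [NeZero n] (hn : 1 ≤ n) (M : Fin d → ℕ) [hM : ∀ μ, NeZero (M μ)] (a : ℝ) (ha : 0 < a)
variable {ρ : Tor (fine n M) × Fin d → ℝ} {κ : ℝ}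


/-- **THE SHIFT UNDER CONJUGATION**: for a weight with `|ρ(x + e_ν, μ) − ρ(x, μ)| ≤ 1/n`, `‖c(S_ν) − S_ν‖ ≤ e^{|κ|/n} − 1` (one nonzero entry
per row and per column; Schur). [folklore] -/
theorem opNorm_conjMat_shiftM_sub_le (κ : ℝ) (hℓ : ∀ (x : Tor (fine n M)) (μ ν : Fin d), |ρ (x + unitVec (fine n M) ν, μ) - ρ (x, μ)| ≤ 1 / n)
    (ν : Fin d) : ‖conjMat κ ρ ρ (shiftM (fine n M) ν) - shiftM (fine n M) ν‖ ≤ Real.exp (|κ| * (1 / n)) - 1 := by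
  have h := opNorm_conjMat_sub_le_schur κ ρ ρ (shiftM (fine n M) ν) (ℓ := 1 / n) (R := 1) (C := 1) (by positivity) zero_le_one
    zero_le_one ?_ ?_ ?_
  · simpa using h
  · intro e e' hX
    have he' : e' = (e.1 + unitVec (fine n M) ν, e.2) := by
      by_contra hne; exact hX (by simp [shiftM, hne])
    rw [he', abs_sub_comm]
    have := hℓ e.1 e.2 ν
    exact this
  · intro e
    rw [Finset.sum_eq_single (e.1 + unitVec (fine n M) ν, e.2)]
    · simp [shiftM]
    · intro b _ hb; simp [shiftM, hb]
    · intro h; exact absurd (Finset.mem_univ _) h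
  · intro e'
    rw [Finset.sum_eq_single (e'.1 - unitVec (fine n M) ν, e'.2)]
    · simp [shiftM]
    · intro b _ hb
      have : e' ≠ (b.1 + unitVec (fine n M) ν, b.2) := by
        intro h; apply hb; rw [h]; simp
      simp [shiftM, this]
    · intro h; exact absurd (Finset.mem_univ _) h

include hn in
/-- hence `‖c(S_ν)‖ ≤ e^{|κ|}` (`e^{|κ|/n} ≤ e^{|κ|}`). [folklore] -/
theorem opNorm_conjMat_shiftM_le (κ : ℝ) (hℓ : ∀ (x : Tor (fine n M)) (μ ν : Fin d), |ρ (x + unitVec (fine n M) ν, μ) - ρ (x, μ)| ≤ 1 / n)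
    (ν : Fin d) : ‖conjMat κ ρ ρ (shiftM (fine n M) ν)‖ ≤ Real.exp |κ| := by
  have hn1 : (1 : ℝ) ≤ n := by exact_mod_cast hn
  have h1 := opNorm_conjMat_shiftM_sub_le n M κ hℓ ν
  have h2 : Real.exp (|κ| * (1 / n)) ≤ Real.exp |κ| :=
    Real.exp_le_exp.mpr (by rw [mul_one_div]; exact div_le_self (abs_nonneg κ) hn1)
  calc ‖conjMat κ ρ ρ (shiftM (fine n M) ν)‖ ≤ ‖shiftM (fine n M) ν‖ + ‖conjMat κ ρ ρ (shiftM (fine n M) ν) - shiftM (fine n M) ν‖ :=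
        opNorm_conjMat_le_add κ ρ ρ _
    _ ≤ 1 + (Real.exp (|κ| * (1 / n)) - 1) := add_le_add (opNorm_shiftM_le _ ν) h1
    _ ≤ Real.exp |κ| := by linarith

include hn in
/-- and `‖c(S_νᴴ)‖ ≤ e^{|κ|}` (`c_κ(Xᴴ) = (c_{−κ}X)ᴴ`). [folklore] -/
theorem opNorm_conjMat_shiftMH_le (κ : ℝ) (hℓ : ∀ (x : Tor (fine n M)) (μ ν : Fin d), |ρ (x + unitVec (fine n M) ν, μ) - ρ (x, μ)| ≤ 1 / n)
    (ν : Fin d) : ‖conjMat κ ρ ρ (shiftM (fine n M) ν)ᴴ‖ ≤ Real.exp |κ| := by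
  rw [conjMat_conjTranspose, Matrix.l2_opNorm_conjTranspose]
  have h := opNorm_conjMat_shiftM_le n hn M (-κ) hℓ ν
  rwa [abs_neg] at h

include hn in
/-- **THE DIFFERENCE UNDER CONJUGATION, `n`-UNIFORMLY**: `‖c(∇_ν) − ∇_ν‖ ≤ |κ|·e^{|κ|}` (`∇_ν = n(S_ν − 1)`, `n(e^{|κ|/n} − 1) ≤ |κ|e^{|κ|}`).
[folklore] -/
theorem opNorm_conjMat_fdiff_sub_le (κ : ℝ) (hℓ : ∀ (x : Tor (fine n M)) (μ ν : Fin d), |ρ (x + unitVec (fine n M) ν, μ) - ρ (x, μ)| ≤ 1 / n)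
    (ν : Fin d) :
    ‖conjMat κ ρ ρ (fdiff (fine n M) ((n : ℕ) : ℂ) ν) - fdiff (fine n M) ((n : ℕ) : ℂ) ν‖ ≤ |κ| * Real.exp |κ| := by
  have e : conjMat κ ρ ρ (fdiff (fine n M) ((n : ℕ) : ℂ) ν) - fdiff (fine n M) ((n : ℕ) : ℂ) ν
      = ((n : ℕ) : ℂ) • (conjMat κ ρ ρ (shiftM (fine n M) ν) - shiftM (fine n M) ν) := by
    rw [fdiff, conjMat_smul, conjMat_sub, conjMat_one, smul_sub, smul_sub, smul_sub]
    abel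
  rw [e, norm_smul, Complex.norm_natCast]
  calc (n : ℝ) * ‖conjMat κ ρ ρ (shiftM (fine n M) ν) - shiftM (fine n M) ν‖ ≤ n * (Real.exp (|κ| / n) - 1) := by
        have h := opNorm_conjMat_shiftM_sub_le n M κ hℓ ν
        rw [mul_one_div] at h
        exact mul_le_mul_of_nonneg_left h (Nat.cast_nonneg n)
    _ ≤ |κ| * Real.exp |κ| := nat_mul_exp_div_sub_one_le (abs_nonneg κ) hn

/-! ## §2 The weighted gradient bound -/

/-- `G₁(d, a, J, γw) = √((d+1)Cst·(γw⁻¹ + J·γw⁻²))` — the weighted gradient constant. [folklore] -/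
def G1 (d : ℕ) (a J γw : ℝ) : ℝ := Real.sqrt ((((d : ℝ) + 1) * Cst d a) * (1 / γw + J / γw ^ 2))

/-- `G₂ = G₁ + |κ|e^{|κ|}·γw⁻¹` — the conjugated-difference constant. [folklore] -/
def G2 (d : ℕ) (a J γw κ : ℝ) : ℝ := G1 d a J γw + |κ| * Real.exp |κ| * γw⁻¹

omit [NeZero n] hM in
/-- `G₁ ≥ 0`. [folklore] -/
theorem G1_nonneg (J γw : ℝ) : 0 ≤ G1 d a J γw := Real.sqrt_nonneg _

omit [NeZero n] hM in
/-- `G₂ ≥ 0` for `γw > 0`. [folklore] -/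
theorem G2_nonneg (J : ℝ) {γw : ℝ} (hγ : 0 < γw) (κ : ℝ) : 0 ≤ G2 d a J γw κ := by
  unfold G2; have := G1_nonneg (d := d) a J γw; positivity

/-- `Δ_a` is coercive in the `CoerciveInverseTower` reading (the tree's `DirichletRegionTower.coercive_calDa`, arguments swapped). [folklore] -/
theorem coercive_calDa' : Coercive (gamD d a) (calDa n hn M a ha) := fun v => coercive_calDa M a ha n hn v

/-- `Δ_a` has invertible determinant. [folklore] -/
theorem isUnit_det_calDa : IsUnit (calDa n hn M a ha).det :=
  Matrix.isUnit_det_of_right_inverse (calDa_mul_calG n hn M a ha)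

/-- **weighted coercivity from the displayed conjugation defect**: `ConjDefect Δ_a κ ρ J ⟹ WCoercive Δ_a κ ρ (γ_D − J)`. [folklore] -/
theorem wCoercive_calDa_of_conjDefect {J : ℝ} (hJ : ConjDefect (calDa n hn M a ha) κ ρ J) :
    WCoercive (calDa n hn M a ha) κ ρ (gamD d a - J) :=
  wCoercive_of_coercive (coercive_calDa' n hn M a ha) hJ

/-- **THE WEIGHTED GRADIENT BOUND**: `‖∇_ν · c(Δ_a⁻¹)‖ ≤ G₁` with `γw = γ_D − J > 0` — `WCoercive.form_bound` (weighted form ≤ `(γw⁻¹ + Jγw⁻²)‖w‖²`)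
against the gradient form bound `‖∇_ν z‖² ≤ (d+1)Cst·Re⟨z, Δ_a z⟩`. [cite: Balaban1984PropagatorsI, Prop. 1.1 (1.90) p.33 (the gradient form
bound, kernel version of the tree)] [folklore] -/
theorem opNorm_fdiff_mul_conjMat_inv_le {J : ℝ} (hJ : ConjDefect (calDa n hn M a ha) κ ρ J) (hJ0 : 0 ≤ J) (hJγ : J < gamD d a)
    (ν : Fin d) : ‖fdiff (fine n M) ((n : ℕ) : ℂ) ν * conjMat κ ρ ρ (calDa n hn M a ha)⁻¹‖ ≤ G1 d a J (gamD d a - J) := by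
  set D := calDa n hn M a ha with hD
  set γw := gamD d a - J with hγw
  have hγ : 0 < γw := sub_pos.mpr hJγ
  have hW : WCoercive D κ ρ γw := wCoercive_calDa_of_conjDefect n hn M a ha hJ
  have hU : IsUnit D.det := isUnit_det_calDa n hn M a ha
  have hK : 0 ≤ (((d : ℝ) + 1) * Cst d a) * (1 / γw + J / γw ^ 2) := by
    have := (K_pos (d := d) a).le; positivity
  refine opNorm_le_of_nsq_le_rect _ (G1_nonneg (d := d) a J γw) fun v => ?_
  -- `z = c(D⁻¹) v = e^{κρ} x`, `x = D⁻¹ e^{−κρ} v`, `D x = e^{−κρ} v`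
  set x : Tor (fine n M) × Fin d → ℂ := D⁻¹ *ᵥ wvec (-κ) ρ v with hx
  have hDx : D *ᵥ x = wvec (-κ) ρ v := by rw [hx, Matrix.mulVec_mulVec, Matrix.mul_nonsing_inv D hU, Matrix.one_mulVec]
  have hz : conjMat κ ρ ρ D⁻¹ *ᵥ v = wvec κ ρ x := by rw [conjMat_mulVec]
  have hform := hW.form_bound hγ hJ hJ0 hDx
  rw [wvec_wvec_neg] at hform
  have hgrad := nsq_fdiff_le_form M a ha n hn ν (wvec κ ρ x)
  rw [← Matrix.mulVec_mulVec, hz, G1, Real.sq_sqrt hK]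
  calc nsq (fdiff (fine n M) ((n : ℕ) : ℂ) ν *ᵥ wvec κ ρ x) ≤ ((d : ℝ) + 1) * Cst d a * (star (wvec κ ρ x) ⬝ᵥ (D *ᵥ wvec κ ρ x)).re := hgrad
    _ ≤ ((d : ℝ) + 1) * Cst d a * ((1 / γw + J / γw ^ 2) * nsq v) := mul_le_mul_of_nonneg_left hform (K_pos a).le
    _ = ((d : ℝ) + 1) * Cst d a * (1 / γw + J / γw ^ 2) * nsq v := by ring

/-- **the conjugated inverse**: `‖c(Δ_a⁻¹)‖ ≤ γw⁻¹`. [folklore] -/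
theorem opNorm_conjMat_inv_calDa_le {J : ℝ} (hJ : ConjDefect (calDa n hn M a ha) κ ρ J) (hJγ : J < gamD d a) :
    ‖conjMat κ ρ ρ (calDa n hn M a ha)⁻¹‖ ≤ (gamD d a - J)⁻¹ :=
  opNorm_conjMat_inv_le_of_wCoercive (wCoercive_calDa_of_conjDefect n hn M a ha hJ) (sub_pos.mpr hJγ)

/-- **`‖c(∇_ν)·c(Δ_a⁻¹)‖ ≤ G₂`** (`= G₁ + |κ|e^{|κ|}γw⁻¹`). [folklore] -/
theorem opNorm_conjMat_fdiff_mul_inv_le {J : ℝ} (hJ : ConjDefect (calDa n hn M a ha) κ ρ J) (hJ0 : 0 ≤ J) (hJγ : J < gamD d a)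
    (hℓ : ∀ (x : Tor (fine n M)) (μ ν : Fin d), |ρ (x + unitVec (fine n M) ν, μ) - ρ (x, μ)| ≤ 1 / n) (ν : Fin d) :
    ‖conjMat κ ρ ρ (fdiff (fine n M) ((n : ℕ) : ℂ) ν) * conjMat κ ρ ρ (calDa n hn M a ha)⁻¹‖ ≤ G2 d a J (gamD d a - J) κ := by
  set cG := conjMat κ ρ ρ (calDa n hn M a ha)⁻¹ with hcG
  set F := fdiff (fine n M) ((n : ℕ) : ℂ) ν with hF
  have hγ : 0 < gamD d a - J := sub_pos.mpr hJγ
  have e : conjMat κ ρ ρ F * cG = F * cG + (conjMat κ ρ ρ F - F) * cG := by rw [Matrix.sub_mul]; abel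
  rw [e, G2]
  refine (norm_add_le _ _).trans (add_le_add (opNorm_fdiff_mul_conjMat_inv_le n hn M a ha hJ hJ0 hJγ ν) ?_)
  calc ‖(conjMat κ ρ ρ F - F) * cG‖ ≤ ‖conjMat κ ρ ρ F - F‖ * ‖cG‖ := Matrix.l2_opNorm_mul _ _
    _ ≤ (|κ| * Real.exp |κ|) * (gamD d a - J)⁻¹ :=
        mul_le_mul (opNorm_conjMat_fdiff_sub_le n hn M κ hℓ ν) (opNorm_conjMat_inv_calDa_le n hn M a ha hJ hJγ) (norm_nonneg _)
          (by positivity)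

/-! ## §3 The three pieces of the model perturbations -/

/-- **FIRST-ORDER PIECE**: `‖c(diag W·∇_ν)·c(Δ_a⁻¹)‖ ≤ α·G₂` for `|W| ≤ α` (a diagonal is fixed by the conjugation). [folklore] -/
theorem opNorm_conjMat_firstOrderPiece_le {J : ℝ} (hJ : ConjDefect (calDa n hn M a ha) κ ρ J) (hJ0 : 0 ≤ J) (hJγ : J < gamD d a)
    (hℓ : ∀ (x : Tor (fine n M)) (μ ν : Fin d), |ρ (x + unitVec (fine n M) ν, μ) - ρ (x, μ)| ≤ 1 / n)
    {W : Tor (fine n M) × Fin d → ℂ} {α : ℝ} (hα : 0 ≤ α) (hW : ∀ i, ‖W i‖ ≤ α) (ν : Fin d) :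
    ‖conjMat κ ρ ρ (Matrix.diagonal W * fdiff (fine n M) ((n : ℕ) : ℂ) ν) * conjMat κ ρ ρ (calDa n hn M a ha)⁻¹‖
      ≤ α * G2 d a J (gamD d a - J) κ := by
  rw [conjMat_mul_same, conjMat_diagonal, Matrix.mul_assoc]
  exact (Matrix.l2_opNorm_mul _ _).trans (mul_le_mul (opNorm_diagonal_le _ hα hW)
    (opNorm_conjMat_fdiff_mul_inv_le n hn M a ha hJ hJ0 hJγ hℓ ν) (norm_nonneg _) hα)

/-- **ADJOINT FIRST-ORDER PIECE**: `‖c((diag W·∇_ν)ᴴ)·c(Δ_a⁻¹)‖ ≤ e^{|κ|}·(α·G₂ + β·γw⁻¹)` for `|W| ≤ α` and the Lipschitz bound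
`|W(x + e_ν) − W(x)| ≤ β/n`: `(diag W ∇)ᴴ = ∇ᴴ diag W̄ = −Sᴴ∇ diag W̄ = −Sᴴ(diag(W̄∘τ)∇ + n·(diag(W̄∘τ) − diag W̄))`. [folklore] -/
theorem opNorm_conjMat_adjointPiece_le {J : ℝ} (hJ : ConjDefect (calDa n hn M a ha) κ ρ J) (hJ0 : 0 ≤ J) (hJγ : J < gamD d a)
    (hℓ : ∀ (x : Tor (fine n M)) (μ ν : Fin d), |ρ (x + unitVec (fine n M) ν, μ) - ρ (x, μ)| ≤ 1 / n)
    {W : Tor (fine n M) × Fin d → ℂ} {α β : ℝ} (hα : 0 ≤ α) (hβ : 0 ≤ β) (hW : ∀ i, ‖W i‖ ≤ α) (ν : Fin d)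
    (hLip : ∀ i, ‖W (tau (fine n M) ν i) - W i‖ ≤ β / n) :
    ‖conjMat κ ρ ρ (Matrix.diagonal W * fdiff (fine n M) ((n : ℕ) : ℂ) ν)ᴴ * conjMat κ ρ ρ (calDa n hn M a ha)⁻¹‖
      ≤ Real.exp |κ| * (α * G2 d a J (gamD d a - J) κ + β * (gamD d a - J)⁻¹) := by
  set D := calDa n hn M a ha with hD
  set cG := conjMat κ ρ ρ D⁻¹ with hcG
  set F := fdiff (fine n M) ((n : ℕ) : ℂ) ν with hF
  set S := shiftM (fine n M) ν with hS
  have hγ : 0 < gamD d a - J := sub_pos.mpr hJγ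
  have hnpos : (0 : ℝ) < n := by exact_mod_cast hn
  -- `(diag W·∇)ᴴ = −Sᴴ·(diag(W̄∘τ)·∇ + n·(diag(W̄∘τ) − diag W̄))`
  have e0 : ((n : ℕ) : ℂ) = ((n : ℝ) : ℂ) := by push_cast; rfl
  have hstar : Fᴴ = -(Sᴴ * F) := by
    have h1 := congrArg Matrix.conjTranspose (fdiff_eq_neg_conjTranspose_mul (fine n M) (n : ℝ) ν)
    rw [Matrix.conjTranspose_neg, Matrix.conjTranspose_mul, Matrix.conjTranspose_conjTranspose] at h1
    rw [hF, e0]; exact h1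
  have hadj : (Matrix.diagonal W * F)ᴴ
      = -(Sᴴ * (Matrix.diagonal (star W ∘ tau (fine n M) ν) * F
          + ((n : ℕ) : ℂ) • (Matrix.diagonal (star W ∘ tau (fine n M) ν) - Matrix.diagonal (star W)))) := by
    rw [Matrix.conjTranspose_mul, Matrix.diagonal_conjTranspose, hstar, Matrix.neg_mul, Matrix.mul_assoc, hF, fdiff_mul_diagonal]
  rw [hadj, conjMat_neg, Matrix.neg_mul, norm_neg, conjMat_mul_same, conjMat_add, conjMat_mul_same, conjMat_diagonal, conjMat_smul,
    conjMat_sub, conjMat_diagonal, conjMat_diagonal, Matrix.mul_assoc]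
  -- the two pieces
  have hWt : ∀ i, ‖(star W ∘ tau (fine n M) ν) i‖ ≤ α := fun i => by
    simp only [Function.comp_apply, Pi.star_apply, norm_star]; exact hW _
  have hp1 : ‖Matrix.diagonal (star W ∘ tau (fine n M) ν) * conjMat κ ρ ρ F * cG‖ ≤ α * G2 d a J (gamD d a - J) κ := by
    rw [Matrix.mul_assoc]
    exact (Matrix.l2_opNorm_mul _ _).trans (mul_le_mul (opNorm_diagonal_le _ hα hWt)
      (opNorm_conjMat_fdiff_mul_inv_le n hn M a ha hJ hJ0 hJγ hℓ ν) (norm_nonneg _) hα)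
  have hp2 : ‖((n : ℕ) : ℂ) • (Matrix.diagonal (star W ∘ tau (fine n M) ν) - Matrix.diagonal (star W)) * cG‖
      ≤ β * (gamD d a - J)⁻¹ := by
    rw [Matrix.smul_mul, norm_smul, Complex.norm_natCast, Matrix.diagonal_sub]
    have hdiag : ‖Matrix.diagonal (fun i => (star W ∘ tau (fine n M) ν) i - star W i)‖ ≤ β / n := by
      refine opNorm_diagonal_le _ (by positivity) fun i => ?_
      simp only [Function.comp_apply, Pi.star_apply]
      rw [← star_sub, norm_star]
      exact hLip i
    calc (n : ℝ) * ‖Matrix.diagonal (fun i => (star W ∘ tau (fine n M) ν) i - star W i) * cG‖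
        ≤ n * (β / n * (gamD d a - J)⁻¹) := mul_le_mul_of_nonneg_left ((Matrix.l2_opNorm_mul _ _).trans
          (mul_le_mul hdiag (opNorm_conjMat_inv_calDa_le n hn M a ha hJ hJγ) (norm_nonneg _) (by positivity))) hnpos.le
      _ = β * (gamD d a - J)⁻¹ := by field_simp
  have hsum : ‖(Matrix.diagonal (star W ∘ tau (fine n M) ν) * conjMat κ ρ ρ F
        + ((n : ℕ) : ℂ) • (Matrix.diagonal (star W ∘ tau (fine n M) ν) - Matrix.diagonal (star W))) * cG‖
      ≤ α * G2 d a J (gamD d a - J) κ + β * (gamD d a - J)⁻¹ := by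
    rw [Matrix.add_mul]
    exact (norm_add_le _ _).trans (add_le_add hp1 hp2)
  have h0 : 0 ≤ α * G2 d a J (gamD d a - J) κ + β * (gamD d a - J)⁻¹ := by
    have := G2_nonneg (d := d) a J hγ κ; positivity
  calc ‖conjMat κ ρ ρ Sᴴ * ((Matrix.diagonal (star W ∘ tau (fine n M) ν) * conjMat κ ρ ρ F
          + ((n : ℕ) : ℂ) • (Matrix.diagonal (star W ∘ tau (fine n M) ν) - Matrix.diagonal (star W))) * cG)‖
      ≤ ‖conjMat κ ρ ρ Sᴴ‖ * ‖(Matrix.diagonal (star W ∘ tau (fine n M) ν) * conjMat κ ρ ρ F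
          + ((n : ℕ) : ℂ) • (Matrix.diagonal (star W ∘ tau (fine n M) ν) - Matrix.diagonal (star W))) * cG‖ := Matrix.l2_opNorm_mul _ _
    _ ≤ Real.exp |κ| * (α * G2 d a J (gamD d a - J) κ + β * (gamD d a - J)⁻¹) :=
        mul_le_mul (opNorm_conjMat_shiftMH_le n hn M κ hℓ ν) hsum (norm_nonneg _) (Real.exp_pos _).le

/-- **ZEROTH-ORDER PIECE**: `‖c(diag Z)·c(Δ_a⁻¹)‖ ≤ α′·γw⁻¹` for `|Z| ≤ α′`. [folklore] -/
theorem opNorm_conjMat_diagonal_mul_inv_le {J : ℝ} (hJ : ConjDefect (calDa n hn M a ha) κ ρ J) (hJγ : J < gamD d a)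
    {Z : Tor (fine n M) × Fin d → ℂ} {α' : ℝ} (hα : 0 ≤ α') (hZ : ∀ i, ‖Z i‖ ≤ α') :
    ‖conjMat κ ρ ρ (Matrix.diagonal Z) * conjMat κ ρ ρ (calDa n hn M a ha)⁻¹‖ ≤ α' * (gamD d a - J)⁻¹ := by
  rw [conjMat_diagonal]
  exact (Matrix.l2_opNorm_mul _ _).trans (mul_le_mul (opNorm_diagonal_le _ hα hZ) (opNorm_conjMat_inv_calDa_le n hn M a ha hJ hJγ)
    (norm_nonneg _) hα)

/-- **THE FIRST-ORDER MODEL** `P = Σ_μ diag(W_μ)·∇_μ` (`FirstOrderBackgroundModel.firstOrder`): `‖c(P)·c(Δ_a⁻¹)‖ ≤ d·α·G₂`. [folklore] -/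
theorem opNorm_conjMat_firstOrder_le {J : ℝ} (hJ : ConjDefect (calDa n hn M a ha) κ ρ J) (hJ0 : 0 ≤ J) (hJγ : J < gamD d a)
    (hℓ : ∀ (x : Tor (fine n M)) (μ ν : Fin d), |ρ (x + unitVec (fine n M) ν, μ) - ρ (x, μ)| ≤ 1 / n)
    {W : Fin d → (Tor (fine n M) × Fin d → ℂ)} {α : ℝ} (hα : 0 ≤ α) (hW : ∀ μ i, ‖W μ i‖ ≤ α) :
    ‖conjMat κ ρ ρ (firstOrder (fine n M) ((n : ℕ) : ℂ) W) * conjMat κ ρ ρ (calDa n hn M a ha)⁻¹‖ ≤ d * (α * G2 d a J (gamD d a - J) κ) := by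
  rw [firstOrder, conjMat_finset_sum, Finset.sum_mul]
  refine (norm_sum_le _ _).trans ?_
  have hterm : ∀ μ ∈ Finset.univ, ‖conjMat κ ρ ρ (Matrix.diagonal (W μ) * fdiff (fine n M) ((n : ℕ) : ℂ) μ)
      * conjMat κ ρ ρ (calDa n hn M a ha)⁻¹‖ ≤ α * G2 d a J (gamD d a - J) κ :=
    fun μ _ => opNorm_conjMat_firstOrderPiece_le n hn M a ha hJ hJ0 hJγ hℓ hα (hW μ) μ
  refine (Finset.sum_le_sum hterm).trans (le_of_eq ?_)
  rw [Finset.sum_const, Finset.card_univ, Fintype.card_fin, nsmul_eq_mul]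

/-- **THE ADJOINT FIRST-ORDER MODEL** `Pᴴ = Σ_μ (diag(W_μ)·∇_μ)ᴴ`: `‖c(Pᴴ)·c(Δ_a⁻¹)‖ ≤ d·e^{|κ|}(α·G₂ + β·γw⁻¹)`. [folklore] -/
theorem opNorm_conjMat_firstOrderH_le {J : ℝ} (hJ : ConjDefect (calDa n hn M a ha) κ ρ J) (hJ0 : 0 ≤ J) (hJγ : J < gamD d a)
    (hℓ : ∀ (x : Tor (fine n M)) (μ ν : Fin d), |ρ (x + unitVec (fine n M) ν, μ) - ρ (x, μ)| ≤ 1 / n)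
    {W : Fin d → (Tor (fine n M) × Fin d → ℂ)} {α β : ℝ} (hα : 0 ≤ α) (hβ : 0 ≤ β) (hW : ∀ μ i, ‖W μ i‖ ≤ α)
    (hLip : ∀ μ i, ‖W μ (tau (fine n M) μ i) - W μ i‖ ≤ β / n) :
    ‖conjMat κ ρ ρ (firstOrder (fine n M) ((n : ℕ) : ℂ) W)ᴴ * conjMat κ ρ ρ (calDa n hn M a ha)⁻¹‖
      ≤ d * (Real.exp |κ| * (α * G2 d a J (gamD d a - J) κ + β * (gamD d a - J)⁻¹)) := by
  rw [firstOrder, Matrix.conjTranspose_sum, conjMat_finset_sum, Finset.sum_mul]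
  refine (norm_sum_le _ _).trans ?_
  have hterm : ∀ μ ∈ Finset.univ, ‖conjMat κ ρ ρ (Matrix.diagonal (W μ) * fdiff (fine n M) ((n : ℕ) : ℂ) μ)ᴴ
      * conjMat κ ρ ρ (calDa n hn M a ha)⁻¹‖ ≤ Real.exp |κ| * (α * G2 d a J (gamD d a - J) κ + β * (gamD d a - J)⁻¹) :=
    fun μ _ => opNorm_conjMat_adjointPiece_le n hn M a ha hJ hJ0 hJγ hℓ hα hβ (hW μ) μ (hLip μ)
  refine (Finset.sum_le_sum hterm).trans (le_of_eq ?_)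
  rw [Finset.sum_const, Finset.card_univ, Fintype.card_fin, nsmul_eq_mul]

end OneLevel

end Summit.QuantumFields.BalabanUV.T4Continuum.CTConjugatedHbd

end
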